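import Literature.MathematicalPhysics.QuantumFieldTheory.Balaban1983to89.B9Eq342SupNormBootstrap

/-!
# `Balaban1983to89.B9Eq342SupNormBootstrapWeighted` — T. Bałaban, *Propagators for lattice gauge theories in a background field*, Commun. Math. Phys. **99**
# (1985) 389–434 [Balaban1985BackgroundPropagators] Thm 3.1 (3.42) p. 397, first entry WITH ITS DECAY FACTOR `e^{−δ₀d(y,y′)}`: **THE WEIGHTED BOOTSTRAP — the
# sup-norm-from-energy argument of `B9Eq342SupNormBootstrap` read AT ONE OUTPUT SITE `x₀` against a SUPERSOLUTION WEIGHT `W` (`λW ≤ (L₀+m)W`, e.g. the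
# Agmon∕`cosh` weight centred at `x₀`): `‖u(x₀)‖ ≤ (1 + m∕λ)·s + m²·χ(x₀)` where `s = sup_y (‖f(y)‖ + ‖q(y)‖)∕(λW(y))` is the WEIGHTED size of the data and
# `χ = (L₀+m)⁻²‖u‖` is left to a (weighted) free letter — the abstract half of storey (D) «decay in d(y,y′)» of the NE9 owner's SUP-NORM PROGRAMME** (plan v10
# `g89/SUP-NORM-PROGRAMME.md` §5)

statement-level skeleton of published theorems with citation tags; proofs where landed; nothing here is a claim about the Yang–Mills mass gap

CITATION HEADER (lean-in-tree rule).  Audit cell `pub-balaban`, sub-cell `t4`, BINDER row NE9; filed by the row OWNER lineage `b2b-balaban-t4-ne9-p1` (gen 89).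
Sources as quoted verbatim in `B9Eq342SupNormBootstrap` ([Balaban1985BackgroundPropagators] (3.24)–(3.25), (3.39), Thm 3.1 (3.42) incl. *«… e^{−δ₀d(y,y′)} for
x ∈ Δ(y), y ∈ Λ_j, supp λ ⊂ Δ(y′)»*) and `B9Eq323KatoDomination` ([DodziukMathai2006] §1).  The weight technique is the textbook Agmon∕Combes–Thomas
supersolution method (P. D. Hislop, I. M. Sigal, *Introduction to Spectral Theory*, Ch. 3 — METHOD only; the tree's `B5G183FreeRowSum` §3–§4 uses the same
`cosh` product weight for the free vector propagator); nothing printed is used as a hypothesis.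

WHY THIS FILE.  `norm_le_of_kato_bootstrap` bounds `‖u‖_∞` by the GLOBAL sizes `sup‖f‖`, `sup‖q‖`, `‖u‖_{L²}`; print's (3.42) carries the decay factor
`e^{−δ₀d(y,y′)}` between the block of the output and the block of the source.  Reading the same two dominations against a supersolution weight `W` centred at
the output site replaces every global size by a `W`-weighted one: the data enter through `sup_y(‖f y‖ + ‖q y‖)∕(λW y)` (small when the source is far from the
centre and `W` grows away from it), the solution through the displayed second-resolvent value `χ(x₀)`, which the decayed free letter (D-FS) and the chain's
`L²` block decay (`B9Eq349ConjugatedGreenBlockDecay.exists_block_decay_Gp`) bound by a decaying quantity in the instance file.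

WHAT IS PROVED (sorry-free; 0 `def`; [folklore]).  Data of `B9Eq342SupNormBootstrap` + a weight `W : ι → ℝ`, `0 < W`, `0 < λ`, `λ·W ≤ (L₀+m)W` pointwise.
* `scalar_resolvent_weight_le` — `(L₀+m)Φ = W′`-free form: `(L₀+m)⁻¹W ≤ λ⁻¹W` (monotonicity against the supersolution).
* **`norm_le_of_kato_bootstrap_weighted`** — if `(L u)(x) = f(x) − q(x)`, `‖f y‖ + ‖q y‖ ≤ s·λ·W y` for all `y` (`0 ≤ s`), and `χ` solves the second-level
  scalar equations `(L₀+m)φ_u = ‖u‖`, `(L₀+m)χ = φ_u` (ANY such pair, supplied by `exists_scalar_resolvent`), then at every site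
  `‖u x‖ ≤ s·W x + m·(s·λ⁻¹·W x + m·χ x)`; at a site where `W x₀ = 1`: `‖u x₀‖ ≤ (1 + m∕λ)·s + m²·χ x₀`.
HONEST SCOPE.  Abstract; the weighted free letter bounding `χ(x₀)` and the block-local penalty∕energy letters are the instance's (next file); VALUE row only; no
∇-row.  NOT summit progress (cell pub-balaban: NE9 NOT PRINTED ∕ NOT PROVED; «NE9 ⇐ the named binders»; row WALLED ON A MODEL (O-NE9-1; #5 UNRULED); spine PROVED
0∕9; rung (B)+1 finite T⁴ — NOT infinite volume, NOT mass gap, NOT BetaPertH, NOT Clay).  HONEST DEPENDENCY (cell line): continuum YM on T⁴ ⇐ BetaPertH ∧ nine spine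
estimates (0/9 proved); BetaPertH ⇐ (D1) ∧ (D4) ∧ CAP+tail; G-an2-4 gates asym, D1 and NE2/3/4.  NEW file importing `B9Eq342SupNormBootstrap` only; nothing modified.
Net new unproved facts: 0.
-/

noncomputable section

open scoped InnerProductSpace ComplexConjugate BigOperators

namespace Literature.MathematicalPhysics.QuantumFieldTheory.Balaban1983to89.B9Eq342SupNormBootstrapWeighted

open B9Eq323KatoDomination (scalar_nonneg_of_resolvent scalar_le_of_resolvent norm_le_scalar_of_resolvent exists_scalar_resolvent)
open B9Eq342SupNormBootstrap (scalar_resolvent_mono scalar_resolvent_add_smul scalar_le_mul_of_supersolution)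

variable {𝕜 : Type*} [RCLike 𝕜] {V : Type*} [NormedAddCommGroup V] [InnerProductSpace 𝕜 V]
  {ι J : Type*} [Fintype ι] [Fintype J]

/-- **The scalar resolvent of a supersolution weight is at most `λ⁻¹` times the weight**: `λW ≤ (L₀+m)W`, `(L₀+m)Φ = W` ⟹ `Φ ≤ λ⁻¹W` (comparison).
[cite: DodziukMathai2006, Lemma 1.1 §1] -/
theorem scalar_resolvent_weight_le (nbr : ι → J → ι) (w : ι → J → ℝ) (hw : ∀ x j, 0 ≤ w x j) {m : ℝ} (hm : 0 < m)
    {W : ι → ℝ} {lam : ℝ} (hlam : 0 < lam) (hsup : ∀ x, lam * W x ≤ ∑ j, w x j * (W x - W (nbr x j)) + m * W x)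
    {Φ : ι → ℝ} (hΦ : ∀ x, ∑ j, w x j * (Φ x - Φ (nbr x j)) + m * Φ x = W x) (x : ι) : Φ x ≤ lam⁻¹ * W x :=
  scalar_le_mul_of_supersolution nbr w hw hm (inv_nonneg.2 hlam.le) hsup hΦ (fun y => by rw [← mul_assoc, inv_mul_cancel₀ hlam.ne', one_mul]) x

/-- **THE WEIGHTED BOOTSTRAP.**  `(L u)(x) = f x − q x` (covariant, contractive transporters), a supersolution weight `λW ≤ (L₀+m)W` (`0 < λ`, `0 < m`), data
dominated by the weight `‖f y‖ + ‖q y‖ ≤ s·λ·W y` (`0 ≤ s`), and the second-level scalar solutions `(L₀+m)φ_u = ‖u‖`, `(L₀+m)χ = φ_u`.  Then at every site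
`‖u x‖ ≤ s·W x + m·(s·λ⁻¹·W x + m·χ x)` — the two dominations of `norm_le_of_kato_bootstrap` read against `W` instead of the constants.  With `W` the
Agmon weight centred at `x₀` (`W x₀ = 1`, `W y ≥ κe^{a·d(x₀,y)}`) the data term is `e^{−a·d(x₀, supp)}`-small and `χ x₀` is the decayed free letter's.
[cite: Balaban1985BackgroundPropagators, Thm 3.1 (3.42) p.397, (3.39) p.397] -/
theorem norm_le_of_kato_bootstrap_weighted (nbr : ι → J → ι) (w : ι → J → ℝ) (hw : ∀ x j, 0 ≤ w x j) (T : ι → J → V →ₗ[𝕜] V)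
    (hT : ∀ x j v, ‖T x j v‖ ≤ ‖v‖) {m : ℝ} (hm : 0 < m)
    {W : ι → ℝ} {lam : ℝ} (hlam : 0 < lam) (hsup : ∀ x, lam * W x ≤ ∑ j, w x j * (W x - W (nbr x j)) + m * W x)
    {u f q : ι → V} (hu : ∀ x, ∑ j, (w x j : 𝕜) • (u x - T x j (u (nbr x j))) = f x - q x)
    {s : ℝ} (hs : 0 ≤ s) (hdata : ∀ y, ‖f y‖ + ‖q y‖ ≤ s * (lam * W y))
    {φu χ : ι → ℝ} (hφu : ∀ x, ∑ j, w x j * (φu x - φu (nbr x j)) + m * φu x = ‖u x‖)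
    (hχ : ∀ x, ∑ j, w x j * (χ x - χ (nbr x j)) + m * χ x = φu x) (x : ι) :
    ‖u x‖ ≤ s * W x + m * (s * lam⁻¹ * W x + m * χ x) := by
  -- the resolvent equation `(L + m)u = f − q + m u`
  have hu' : ∀ y, ∑ j, (w y j : 𝕜) • (u y - T y j (u (nbr y j))) + (m : 𝕜) • u y = f y - q y + (m : 𝕜) • u y := fun y => by rw [hu y]
  -- first-level scalar solutions
  obtain ⟨φ₁, hφ₁⟩ := exists_scalar_resolvent nbr w hw hm fun y => ‖f y‖ + ‖q y‖
  obtain ⟨χ₁, hχ₁⟩ := exists_scalar_resolvent nbr w hw hm φ₁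
  -- FIRST DOMINATION by `φ₁ + m φᵤ`
  have hφ := scalar_resolvent_add_smul nbr w m m hφ₁ hφu
  have hdom : ∀ y, ‖u y‖ ≤ φ₁ y + m * φu y := fun y =>
    norm_le_scalar_of_resolvent nbr w hw T hT hm hu' hφ (fun z => by
      refine (norm_add_le _ _).trans (add_le_add (norm_sub_le _ _) ?_)
      rw [norm_smul, RCLike.norm_ofReal, abs_of_pos hm]) y
  -- WEIGHTED maximum principle on `φ₁` and on `χ₁ = (L₀+m)⁻¹φ₁`
  have hφ₁le : ∀ y, φ₁ y ≤ s * W y := scalar_le_mul_of_supersolution nbr w hw hm hs hsup hφ₁ hdata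
  have hχ₁le : ∀ y, χ₁ y ≤ s * lam⁻¹ * W y := fun y => by
    have h := scalar_le_mul_of_supersolution nbr w hw hm (s := s * lam⁻¹) (by positivity) hsup hχ₁ (fun z => ?_) y
    · exact h
    · calc φ₁ z ≤ s * W z := hφ₁le z
        _ = s * lam⁻¹ * (lam * W z) := by field_simp
  -- SECOND DOMINATION (monotonicity): `φᵤ ≤ χ₁ + m χ`
  have hχsum := scalar_resolvent_add_smul nbr w m m hχ₁ hχ
  have hφule : ∀ y, φu y ≤ χ₁ y + m * χ y := fun y => scalar_resolvent_mono nbr w hw hm hφu hχsum hdom y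
  -- assemble
  have h1 := hdom x
  have h2 : m * φu x ≤ m * (s * lam⁻¹ * W x + m * χ x) :=
    mul_le_mul_of_nonneg_left ((hφule x).trans (add_le_add (hχ₁le x) le_rfl)) hm.le
  linarith [hφ₁le x]

/-- **NORMALISED AT THE CENTRE**: if moreover `W x₀ = 1`, then `‖u x₀‖ ≤ (1 + m∕λ)·s + m²·χ x₀`. [cite: Balaban1985BackgroundPropagators, Thm 3.1 (3.42) p.397] -/
theorem norm_le_of_kato_bootstrap_weighted_centre (nbr : ι → J → ι) (w : ι → J → ℝ) (hw : ∀ x j, 0 ≤ w x j) (T : ι → J → V →ₗ[𝕜] V)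
    (hT : ∀ x j v, ‖T x j v‖ ≤ ‖v‖) {m : ℝ} (hm : 0 < m)
    {W : ι → ℝ} {lam : ℝ} (hlam : 0 < lam) (hsup : ∀ x, lam * W x ≤ ∑ j, w x j * (W x - W (nbr x j)) + m * W x)
    {u f q : ι → V} (hu : ∀ x, ∑ j, (w x j : 𝕜) • (u x - T x j (u (nbr x j))) = f x - q x)
    {s : ℝ} (hs : 0 ≤ s) (hdata : ∀ y, ‖f y‖ + ‖q y‖ ≤ s * (lam * W y))
    {φu χ : ι → ℝ} (hφu : ∀ x, ∑ j, w x j * (φu x - φu (nbr x j)) + m * φu x = ‖u x‖)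
    (hχ : ∀ x, ∑ j, w x j * (χ x - χ (nbr x j)) + m * χ x = φu x) {x₀ : ι} (hx₀ : W x₀ = 1) :
    ‖u x₀‖ ≤ (1 + m / lam) * s + m ^ 2 * χ x₀ := by
  have h := norm_le_of_kato_bootstrap_weighted nbr w hw T hT hm hlam hsup hu hs hdata hφu hχ x₀
  rw [hx₀, mul_one, mul_one] at h
  calc ‖u x₀‖ ≤ s + m * (s * lam⁻¹ + m * χ x₀) := h
    _ = (1 + m / lam) * s + m ^ 2 * χ x₀ := by rw [div_eq_mul_inv]; ring

end Literature.MathematicalPhysics.QuantumFieldTheory.Balaban1983to89.B9Eq342SupNormBootstrapWeighted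

end
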